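import Summits.BirchSwinnertonDyer.Rank1Residual.X4.VisibilityPair377600dn1
import Literature.NumberTheory.EllipticCurves.Fisher2012.HesseFamilyFiveIndClosedForms
import HarnessLib

/-!
# BSD rank-≤1 residual cell, class X4 (additive at `p = 5`): `BSD(E,5)` for `377600dn1` — the θ-FREE TWIN of
# the unit's GEN 25 visibility door `X4.bsdp_v377600dn1`, the `5`-congruence `377600a1[5] ≅ 377600dn1[5]`
# now an `n = 5` HESSE-PENCIL CERTIFICATE (Fisher 2013 Thm. 5.8, anti-symplectic family `X_E⁻(5)`) decided by
# `norm_num`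

HONEST FRAMING (cell `b2b-bsdres-*`, verbatim): prove what is provable now; shrink each hard class to its core with
data; no claim beyond stated classes; COMBINATION classes deleted from PUBLISHED theorems only, CONSTRUCTION-shaped
remainder typed; this is not "finishing BSD". Class X4 stays CONSTRUCTION-SHAPED; PER PAIR; nothing booked by this file;
no named fact introduced (the binder `hF'` is the tree's registered fact `thm58_fiveCongruent_hessePencilInd`); no
definition. Unit `b2b-bsdres-x11c`, GEN 37 (prover-b2b-bsdres-x11c-g37-0); successor item 3 of `gen36/README.md`.

WHAT. The GEN 25 door `bsdp_v377600dn1` (`X4/VisibilityPair377600dn1.lean`, p384538; `E = 377600dn1 =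
[0,-1,0,-861918783,9740033309387]`, `N = 377600 = 2⁸·5²·59`, `r_an = 1`, `#Ш_an = 25`, `ρ̄_{E,5}` onto; Kolyvagin
upper half `ord₅ [E(K):ℤy_K] ≤ 1`; VISIBILITY lower half from the rank-`3` partner `E' = 377600a1 = [0,0,0,50,1600]`
with the multiplicative place `59` free) DISPLAYS the congruence as binders `(θ : E'[5] ≃+ E[5]) (hθ : Γ_ℚ-equivariant)`
— the campaign's two engines certified `a_ℓ(E) ≡ a_ℓ(E') (mod 5)` up to the Sturm bound (Kraus–Oesterlé), which the
kernel cannot re-check. Referee A books θ-IN-THE-KERNEL doors only (R400.3). THIS FILE discharges `θ`/`hθ`: the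
rational point `(l : m) = (610204 : 3)` of Fisher's family `X_E⁻(5)` over `E` (anti-symplectic `5`-congruences;
T. Fisher, Math. Ann. 356 (2013) Thm. 5.8 — tree fact `thm58_fiveCongruent_hessePencilInd`, evaluator
`Fisher2012.fiveCongruent_of_hesseIndCertificate`) lands on `E'` with scaling `u = 19660800 = 2⁸·3·5²·…` :
`4·𝔠₄⁻(l,m) = 9·u⁴·c₄(E')` and `8·𝔠₆⁻(l,m) = 27·u⁶·c₆(E')` with `c₄(E) = 41372101600`, `c₆(E) = -8415140546700800`,
`c₄(E') = -2400`, `c₆(E') = -1382400` — two `norm_num` identities (found by PARI: the symplectic family `X_E(5)` has NO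
rational point over `E'` in either direction — degree-60 resultant without a linear factor, kit j297475 —, the
anti-symplectic one has `(610204 : 3)` over `E` and `(132 : 1)` over `E'`, kit j297504; both verified in exact rational
arithmetic before typing). Hence `θ : E'[5] ≃ E[5]` exists IN THE KERNEL modulo the published fact, and the record below
is `bsdp_v377600dn1` with `θ`/`hθ` supplied — every other binder (the named facts `hCT hGZK hU2 hKo hB`, the Heegner
datum with `ord₅ [E(K):ℤP] ≤ 1`, `r_an = 1`, `#Ш_an = s` with `ord₅ s = 2`, and `hloc5 : E'(ℚ₅)[5] = 0`) is the
door's own, token for token. What the record is worth is the referee's call.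

References: T. Fisher, *Invariant theory for the elliptic normal quintic, I. Twists of X(5)*, Math. Ann. 356 (2013)
Thm. 5.8 [Fisher2013QuinticTwists]; T. Fisher, Proc. LMS 104 (2012) §8, §13 [Fisher2012Hessian]; Cremona–Mazur
2000 §3 [CremonaMazur2000]; Agashe–Stein 2002 Thm. 3.1 [AgasheStein2002]; McCallum 1991 §1 [McCallumLMS1991];
Miller 2011 Def. 1.1 [Miller2011LMS]; Cremona's tables [Cremona2006].
-/

set_option autoImplicit false

noncomputable section

open scoped Classical

open WeierstrassCurve Literature.NumberTheory.EllipticCurves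
  Literature.NumberTheory.EllipticCurves.Rank1Residual
  Literature.NumberTheory.EllipticCurves.Rank1Residual.Typed
  Literature.NumberTheory.EllipticCurves.Fisher2012
open NumberField IsDedekindDomain

namespace Summit.BirchSwinnertonDyer.Rank1Residual.X4

/-- **`BSD(E,5)` for `377600dn1`, θ-free** (cell `(377600dn1, 5)`, class X4, rank 1, `#Ш_an = 25`): the GEN 25
visibility door `bsdp_v377600dn1` with its congruence binders `θ`/`hθ` DISCHARGED by the `n = 5` anti-symplectic
Hesse-pencil certificate `(l : m) = (610204 : 3)`, `u = 19660800` of the family `X_E⁻(5)` over `E` landing on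
`E' = 377600a1` (`Fisher2012.fiveCongruent_of_hesseIndCertificate`; Fisher 2013 Thm. 5.8 = the registered fact `hF'`).
Remaining binders, verbatim the door's: `hCT` (Cassels–Tate), `hGZK`, `hU2` (Tate uniformisation), Kolyvagin as
printed (`hKo`, `hB`), the Heegner datum (`K`, `N`, `P`, `ord₅ [E(K):ℤP] ≤ 1` — the unit's GEN 25 three-engine index
line, displayed), `r_an = 1`, `#Ш_an = s` with `ord₅ s = 2` (Cremona), `hloc5 : E'(ℚ₅)[5] = 0` (displayed; type `IV`
at `5`, tame). Per pair; nothing booked by this file. [cite: Fisher2013QuinticTwists, Thm. 5.8]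
[cite: Fisher2012Hessian, §8 and §13] [cite: CremonaMazur2000, §3] [cite: McCallumLMS1991, §1 Theorem (Kolyvagin), p. 296]
[cite: Cremona2006, Table 1 (labels 377600dn1, 377600a1)] -/
theorem bsdpHesse_v377600dn1 (hF' : thm58_fiveCongruent_hessePencilInd)
    (hCT : exists_casselsTate_pairing (K := ℚ))
    (hGZK : rank_eq_analyticRank_of_analyticRank_le_one)
    (hU2 : Silverman1994_thmV53_corV54_tateUniformisation.{0})
    (W : WeierstrassCurve ℚ) (hW : W = ⟨0, -1, 0, -861918783, 9740033309387⟩)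
    {N : ℕ} [NeZero N] {K : Type} [Field K] [NumberField K] (hKo : kolyvagin N W K)
    (hB : Kolyvagin1990_padicValNat_card_sha_le N W K) (hK : IsImaginaryQuadratic K)
    (hH : SatisfiesHeegnerHypothesis N K) {P : (W.baseChange K).toAffine.Point}
    (hP : IsHeegnerPoint N W K P) (hnt : ¬ IsOfFinAddOrder P)
    (hI : padicValNat 5 (AddSubgroup.zmultiples P).index ≤ 1)
    (hr : W.analyticRank = 1) {s : ℚ} (hs : shaAn W = (s : ℂ)) (hv : padicValRat 5 s = 2)
    (hloc5 : ∀ v : HeightOneSpectrum (𝓞 ℚ), (Rat.HeightOneSpectrum.primesEquiv v : ℕ) = 5 →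
      Nat.card (nsmulAddMonoidHom 5 :
        ((⟨0, 0, 0, 50, 1600⟩ : WeierstrassCurve ℚ).baseChange (v.adicCompletion ℚ)).toAffine.Point →+ _).ker = 1) :
    BSDp W 5 := by
  haveI hE : W.IsElliptic := by
    subst hW; exact X11b.isElliptic_of_discOf_ne_zero 0 (-1) 0 (-861918783) 9740033309387 (by decide +kernel)
  haveI hE' : (⟨0, 0, 0, 50, 1600⟩ : WeierstrassCurve ℚ).IsElliptic :=
    X11b.isElliptic_of_discOf_ne_zero 0 0 0 50 1600 (by decide +kernel)
  have hc4 : W.c₄ = (41372101600 : ℚ) := by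
    subst hW; norm_num [WeierstrassCurve.c₄, WeierstrassCurve.b₂, WeierstrassCurve.b₄]
  have hc6 : W.c₆ = (-8415140546700800 : ℚ) := by
    subst hW; norm_num [WeierstrassCurve.c₆, WeierstrassCurve.b₂, WeierstrassCurve.b₄, WeierstrassCurve.b₆]
  have hc4' : (⟨0, 0, 0, 50, 1600⟩ : WeierstrassCurve ℚ).c₄ = (-2400 : ℚ) := by
    norm_num [WeierstrassCurve.c₄, WeierstrassCurve.b₂, WeierstrassCurve.b₄]
  have hc6' : (⟨0, 0, 0, 50, 1600⟩ : WeierstrassCurve ℚ).c₆ = (-1382400 : ℚ) := by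
    norm_num [WeierstrassCurve.c₆, WeierstrassCurve.b₂, WeierstrassCurve.b₄, WeierstrassCurve.b₆]
  obtain ⟨θ, hθ⟩ := fiveCongruent_of_hesseIndCertificate hF' W (⟨0, 0, 0, 50, 1600⟩ : WeierstrassCurve ℚ)
    (610204 : ℚ) 3 (19660800 : ℚ) (by norm_num)
    (by rw [hc4, hc6, hc4', eval_hesseC4ind]; norm_num) (by rw [hc4, hc6, hc6', eval_hesseC6ind]; norm_num)
  exact bsdp_v377600dn1 hCT hGZK hU2 W hW hKo hB hK hH hP hnt hI hr hs hv _ rfl θ hθ hloc5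

end Summit.BirchSwinnertonDyer.Rank1Residual.X4

end
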